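import Summits.BirchSwinnertonDyer.BirchSwinnertonDyer.Theorems.ResidualThetaTransportAtTwoResidualSignedLambdaLowerCMAtTwoCharIdealLambda
import Summits.BirchSwinnertonDyer.BirchSwinnertonDyer.Theorems.ResidualThetaTransportAtTwoLambdaLowerBoundOExact
import HarnessLib

/-!
# λ-assembly of RSL_g (STUB-PLAN rev 3 §3 Steps 4, 6–8 in algebra): `K ⊗_A M` is finite-dimensional for torsion
# `A⟦X⟧`-modules; the rank-one kernel lemma (`𝔖 = 0`); four-term sequence + flank comparison ⇒ corank bound

Route `ResidualThetaTransportAtTwo` (RTT), crux RSL_g `ResidualSignedLambdaLowerCMAtTwo` (stmt-BirchSwinnertonDyer-22608).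
Seat `prover-bsd-wall-rtt-p2` g15 (`--supports`, closes nothing). Sequel of `…CharIdealLengths/…CharIdealLambdaBlocks/…CharIdealLambda`.
THEOREMS ONLY (no definition, no named fact, no instance, no `sorry`); pure algebra over `Λ = A⟦X⟧`, `A` a complete
DVR, `K = Frac A`; nothing about curves; BSD is not proved by any of this.

## What
* §1 **`finite_baseChange_of_isTorsion`** — for a finitely generated TORSION `Λ`-module `M` (any compatible `A`-structure),
  `K ⊗_A M` is finite-dimensional over `K` (structure theorem + Weierstrass blocks). This discharges the
  `FiniteDimensional K (K ⊗ ·)` instances demanded by the λ-additivity lemmas `LambdaLowerBoundO.finrank_baseChange_add_eq_of_exact`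
  (p625690) WITHOUT any `μ = 0` / `A`-finiteness hypothesis.
* §2 (adapted from the crux sketch `Cruxes/ResidualThetaCountLowerPureAtTwo/Sketch_sidea_k1_g2.lean`, stub-ideation k1 g2 §B,
  there kernel-checked but not importable) the RANK-ONE KERNEL LEMMA of DAG node N3/`𝔖 = 0`:
  `injective_of_dep_of_apply_ne_zero`, `dep_of_rank_le_one`, `comap_eq_bot_of_le_ker`, and the Cayley–Hamilton kill
  `det_smul_mem_range` (`E_v·z ∈ 𝐇¹_str`).
* §3 ASSEMBLY (DAG N7 / Step 8 in `dim_K (K ⊗_A ·)` currency): **`le_finrank_baseChange_of_fourTerm`** — an exact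
  `0 → H1Z → Q → X → X0 → 0` of torsion `Λ`-modules with `m ≤ λ(Q)` and `λ(H1Z) ≤ λ(X0)` gives `m ≤ λ(X)`;
  **`le_finrank_baseChange_of_fourTerm_of_span_C_mul_charIdeal_eq`** — the flank comparison supplied by
  `(C c)·char(H2) = (C d)·char(H1Z)` (BT26 shape, via H-λchar) and `λ(H2) ≤ λ(X0)` (compact Poitou–Tate, V7);
  **`add_le_finrank_baseChange_of_shortExact`** — the imprimitive increment `0 → L → X_{S₀} → X → 0`, `s ≤ λ(L)`;
  **`le_finrank_quotientTorsion_of_le_finrank_baseChange`** — back to the `rank_A(X/X_tors)` currency of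
  `cmLambdaLower_of_corank` (`hcorank`).

References: [Washington1997] §13.2; [Kobayashi2003] Thm. 7.3 (four-term sequence (7.21)); [GreenbergVatsal2000] §2;
[Kato2004Asterisque] Thm. 12.4 (2); [BurungaleTian2026] Thm. 2.6.
-/

set_option autoImplicit false
-- the Theorems namespace of this sub repeats the summit name by design (D-0017 nested layout)
set_option linter.dupNamespace false

noncomputable section

open scoped TensorProduct Classical

namespace Summit.BirchSwinnertonDyer.BirchSwinnertonDyer.Theorems.CharIdealLambda

open Literature.NumberTheory.EllipticCurves

universe u v v' v'' v''' w

/-! ## §1 `K ⊗_A M` is finite-dimensional for finitely generated torsion `A⟦X⟧`-modules -/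

section Finite

variable {A : Type u} [CommRing A] [IsDomain A] [IsDiscreteValuationRing A]
  [IsAdicComplete (IsLocalRing.maximalIdeal A) A]
variable (K : Type w) [Field K] [Algebra A K] [IsFractionRing A K]

/-- **`K ⊗_A M` is finite-dimensional** for a finitely generated torsion module `M` over `Λ = A⟦X⟧` (`A` a complete
DVR, `K = Frac A`, any compatible `A`-structure on `M`): `M` is pseudo-isomorphic to `Π Λ/(gᵢ^{eᵢₖ})`, whose blocks
become finite-dimensional (`…CharIdealLambdaBlocks`), and pseudo-isomorphisms become isomorphisms after `K ⊗_A ·`.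
(No `μ = 0` hypothesis: the `(ϖ)`-blocks die.) [cite: Washington1997, §13.2 (Thm. 13.12, Prop. 13.8)] -/
theorem finite_baseChange_of_isTorsion (M : Type v) [AddCommGroup M] [Module (PowerSeries A) M] [Module A M]
    [IsScalarTower A (PowerSeries A) M] [Module.Finite (PowerSeries A) M] (hM : Module.IsTorsion (PowerSeries A) M) :
    Module.Finite K (K ⊗[A] M) := by
  have hprinc : ∀ 𝔮 : PrimeSpectrum (PowerSeries A), 𝔮.asIdeal.height = 1 → ∃ g : PowerSeries A,
      𝔮.asIdeal = Ideal.span {g} := fun 𝔮 h ↦ by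
    haveI := UniqueFactorizationMonoid.isPrincipal_of_height_eq_one (p := 𝔮.asIdeal) h
    exact Submodule.IsPrincipal.principal 𝔮.asIdeal
  let gen : PrimeSpectrum (PowerSeries A) → PowerSeries A := fun 𝔮 ↦
    if h : 𝔮.asIdeal.height = 1 then Classical.choose (hprinc 𝔮 h) else 0
  have hgen : ∀ 𝔮 : PrimeSpectrum (PowerSeries A), 𝔮.asIdeal.height = 1 →
      Module.annihilator (PowerSeries A) M ≤ 𝔮.asIdeal → 𝔮.asIdeal = Ideal.span {gen 𝔮} := by
    intro 𝔮 h _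
    simp only [gen, dif_pos h]
    exact Classical.choose_spec (hprinc 𝔮 h)
  obtain ⟨n, q, -, hq, r, e, -, θ, hθ⟩ := Module.exists_isPseudoIsomorphism_pi M hM gen hgen
  have hqgen : ∀ i, (q i).asIdeal = Ideal.span {gen (q i)} := fun i ↦ hgen _ (hq i).1 (hq i).2
  haveI : ∀ i k, Module.Finite K (K ⊗[A] (PowerSeries A ⧸ Ideal.span {gen (q i) ^ e i k})) := fun i k ↦
    (finite_and_finrank_baseChange_quotient_span_pow K (q i) (hq i).1 (hqgen i) (e i k)).1
  haveI : ∀ i, Module.Finite K (K ⊗[A] (Π k : Fin (r i), PowerSeries A ⧸ Ideal.span {gen (q i) ^ e i k})) := fun i ↦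
    Module.Finite.equiv
      (TensorProduct.piRight A K K (fun k : Fin (r i) ↦ PowerSeries A ⧸ Ideal.span {gen (q i) ^ e i k})).symm
  haveI : Module.Finite K (K ⊗[A] (Π i, Π k : Fin (r i), PowerSeries A ⧸ Ideal.span {gen (q i) ^ e i k})) :=
    Module.Finite.equiv
      (TensorProduct.piRight A K K (fun i ↦ Π k : Fin (r i), PowerSeries A ⧸ Ideal.span {gen (q i) ^ e i k})).symm
  -- `K ⊗ θ` is bijective
  obtain ⟨ϖ, hϖ⟩ := IsDiscreteValuationRing.exists_irreducible A
  have hϖm : ϖ ∈ IsLocalRing.maximalIdeal A :=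
    (IsDiscreteValuationRing.irreducible_iff_uniformizer ϖ).mp hϖ ▸ Ideal.mem_span_singleton_self ϖ
  haveI : Module.Flat A K := IsLocalization.flat K (nonZeroDivisors A)
  have hbij := Module.bijective_baseChange_of_pow_smul K (isUnit_algebraMap_of_ne_zero K hϖ.ne_zero)
    (θ.restrictScalars A) (fun x hx ↦ ?_) (fun y ↦ ?_)
  · exact Module.Finite.equiv (LinearEquiv.ofBijective _ hbij).symm
  · obtain ⟨k, hk⟩ := exists_C_pow_smul_eq_zero_of_isPseudoNull hϖm hθ.1 ⟨x, hx⟩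
    refine ⟨k, ?_⟩
    have hk' := congrArg Subtype.val hk
    simp only [SetLike.val_smul, ZeroMemClass.coe_zero] at hk'
    rwa [pow_smul_eq_C_pow_smul]
  · obtain ⟨k, hk⟩ := exists_C_pow_smul_eq_zero_of_isPseudoNull hϖm hθ.2 (Submodule.Quotient.mk y)
    rw [← Submodule.Quotient.mk_smul, Submodule.Quotient.mk_eq_zero, LinearMap.mem_range] at hk
    obtain ⟨x, hx⟩ := hk
    exact ⟨k, x, by rw [LinearMap.restrictScalars_apply, hx, pow_smul_eq_C_pow_smul]⟩

end Finite

/-! ## §2 The rank-one kernel lemma (DAG N3: `𝔖 = 0`) and the Cayley–Hamilton kill -/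

section RankOne

-- adapted from Cruxes/ResidualThetaCountLowerPureAtTwo/Sketch_sidea_k1_g2.lean §B (stub-ideation k1 g2)

variable {R : Type u} [CommRing R] {M : Type v} {N : Type v'} {P : Type v''} [AddCommGroup M] [Module R M]
  [AddCommGroup N] [Module R N] [AddCommGroup P] [Module R P]

/-- **Rank-`≤ 1` source, torsion-free target, one non-vanishing value ⇒ injective** — abstract form of
«`𝐇¹(T_g)` torsion free of `Λ_𝒪`-rank 1 (Kato 12.4 (2)) and `Col⁺(loc₂ z_g) ≠ 0` (ERL, `L⁻_g ≠ 0`) ⇒ `Col⁺ ∘ loc₂` is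
injective on `𝐇¹(T_g)`». `hdep`: any two elements are linearly dependent (`dep_of_rank_le_one`).
[cite: Kobayashi2003, Thm. 7.3 (proof)] [cite: Kato2004Asterisque, Thm. 12.4 (2) (p. 221)] -/
theorem injective_of_dep_of_apply_ne_zero [IsDomain R] [Module.IsTorsionFree R M] [Module.IsTorsionFree R N]
    (f : M →ₗ[R] N) (hdep : ∀ m z : M, ∃ a b : R, (a ≠ 0 ∨ b ≠ 0) ∧ a • m = b • z) {z : M} (hz : f z ≠ 0) :
    Function.Injective f := by
  rw [← LinearMap.ker_eq_bot, Submodule.eq_bot_iff]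
  intro m hm
  rw [LinearMap.mem_ker] at hm
  obtain ⟨a, b, hab, h⟩ := hdep m z
  have hbz : b • f z = 0 := by rw [← map_smul, ← h, map_smul, hm, smul_zero]
  rcases hab with ha | hb
  · have hb : b = 0 := (smul_eq_zero.mp hbz).resolve_right hz
    rw [hb, zero_smul] at h
    exact (smul_eq_zero.mp h).resolve_left ha
  · exact absurd ((smul_eq_zero.mp hbz).resolve_left hb) hz

/-- **Rank `≤ 1` ⇒ any two elements are linearly dependent** (the bridge from the binder `Module.rank Λ_𝒪 I.H = 1` of
`Kato2004.thm12_4_newform` to `hdep`). [cite: Kato2004Asterisque, Thm. 12.4 (2) (p. 221)] -/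
theorem dep_of_rank_le_one [Nontrivial R] (h : Module.rank R M ≤ 1) (m z : M) :
    ∃ a b : R, (a ≠ 0 ∨ b ≠ 0) ∧ a • m = b • z := by
  by_contra hcon
  push Not at hcon
  have hli : LinearIndependent R ![m, z] := by
    rw [LinearIndependent.pair_iff]
    intro s t hst
    by_contra hst'
    have hs : s ≠ 0 ∨ -t ≠ 0 := by
      by_cases h0 : s = 0
      · exact Or.inr (by rw [ne_eq, neg_eq_zero]; exact fun ht ↦ hst' ⟨h0, ht⟩)
      · exact Or.inl h0
    apply hcon s (-t) hs
    rw [neg_smul, eq_neg_iff_add_eq_zero, hst]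
  have h2 := hli.cardinal_lift_le_rank
  rw [Cardinal.mk_fin, Cardinal.lift_natCast] at h2
  have h1 : Cardinal.lift.{0} (Module.rank R M) ≤ Cardinal.lift.{0} (1 : Cardinal) := Cardinal.lift_le.mpr h
  rw [Cardinal.lift_one] at h1
  have h21 := h2.trans h1
  have : Nat.succ (Nat.succ 0) ≤ 1 := by exact_mod_cast h21
  omega

/-- **The Poitou–Tate obstruction module is `⊥`** (DAG N3, `𝔖 = 0`): `M = 𝐇¹(T_g)`, `P = H¹_Iw(ℚ₂, T_g)`, `loc : M → P`,
`Ann ⊆ P` the annihilator of the plus condition, `Col : P → Λ_𝒪` with `Ann ≤ ker Col`; if `M` is torsion free of rank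
`≤ 1` and `Col (loc z) ≠ 0` for one `z`, then `loc⁻¹(Ann) = ⊥`. [cite: Kobayashi2003, Thm. 7.3] [cite: GreenbergVatsal2000, Prop. 2.1] -/
theorem comap_eq_bot_of_le_ker [IsDomain R] [Module.IsTorsionFree R M] [Module.IsTorsionFree R N]
    (loc : M →ₗ[R] P) (Ann : Submodule R P) (Col : P →ₗ[R] N) (hAnn : Ann ≤ LinearMap.ker Col)
    (hdep : ∀ m z : M, ∃ a b : R, (a ≠ 0 ∨ b ≠ 0) ∧ a • m = b • z) {z : M} (hz : Col (loc z) ≠ 0) :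
    Ann.comap loc = ⊥ := by
  have hinj : Function.Injective (Col.comp loc) :=
    injective_of_dep_of_apply_ne_zero (Col.comp loc) hdep (z := z) (by simpa using hz)
  rw [Submodule.eq_bot_iff]
  intro m hm
  have h0 : Col (loc m) = 0 := LinearMap.mem_ker.mp (hAnn (Submodule.mem_comap.mp hm))
  exact hinj (by rw [LinearMap.comp_apply, h0, map_zero])

variable {Λ : Type u} {Q : Type v} [CommRing Λ] [AddCommGroup Q] [Module Λ Q]

/-- **Cayley–Hamilton kill: `det φ · x ∈ range φ`** for an endomorphism `φ` of a finite free module (adjugate identity).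
With `Q = T^{I_v} ⊗ Λ_v`, `φ = Frob_v·γ_v⁻¹ − 1`: the Euler factor `E_v = det φ` kills `coker φ ≅ H¹_{ur,Iw}(ℚ_v, T_g)`, so
`E·z_g` lies in the strict-at-`S₀` Iwasawa cohomology. [cite: GreenbergVatsal2000, Prop. 2.4] -/
theorem det_smul_mem_range [Module.Free Λ Q] [Module.Finite Λ Q] (f : Q →ₗ[Λ] Q) (x : Q) :
    LinearMap.det f • x ∈ LinearMap.range f := by
  classical
  haveI : Fintype (Module.Free.ChooseBasisIndex Λ Q) := Module.Free.ChooseBasisIndex.fintype Λ Q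
  let b := Module.Free.chooseBasis Λ Q
  set B := LinearMap.toMatrix b b f with hB
  refine ⟨b.equivFun.symm (B.adjugate.mulVec (b.equivFun x)), ?_⟩
  apply b.equivFun.injective
  have hrepr : ∀ y : Q, b.equivFun (f y) = B.mulVec (b.equivFun y) := by
    intro y
    have := LinearMap.toMatrix_mulVec_repr b b f y
    simpa [Module.Basis.equivFun_apply, hB] using this.symm
  rw [hrepr, LinearEquiv.apply_symm_apply, Matrix.mulVec_mulVec, Matrix.mul_adjugate,
    Matrix.smul_mulVec, Matrix.one_mulVec, map_smul, hB, LinearMap.det_toMatrix]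

end RankOne

/-! ## §3 The λ-assembly: four-term sequence, flank comparison, imprimitive increment, corank currency -/

section Assembly

variable {A : Type u} [CommRing A] [IsDomain A] [IsDiscreteValuationRing A]
  [IsAdicComplete (IsLocalRing.maximalIdeal A) A]
variable (K : Type w) [Field K] [Algebra A K] [IsFractionRing A K]
variable {H1Z Q X X0 : Type v}
  [AddCommGroup H1Z] [Module A H1Z]
  [AddCommGroup Q] [Module (PowerSeries A) Q] [Module A Q] [IsScalarTower A (PowerSeries A) Q]
  [Module.Finite (PowerSeries A) Q]
  [AddCommGroup X] [Module (PowerSeries A) X] [Module A X] [IsScalarTower A (PowerSeries A) X]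
  [Module.Finite (PowerSeries A) X]
  [AddCommGroup X0] [Module A X0]

/-- **Four-term sequence + flank comparison ⇒ corank bound** (Kobayashi (7.21) / STUB-PLAN §3 Steps 6 & 8 in λ-currency):
for `A`-linear maps forming an exact `0 → H1Z → Q → X → X0 → 0` with `Q`, `X` finitely generated torsion `Λ`-modules
(`H1Z = 𝐇¹/Z`, `Q = Λ_𝒪/(c·Lm) ≅ P/Col⁺(Z)`, `X = X⁺_∅`, `X0 = X₀^{prim}`), `m ≤ λ(Q)` and `λ(H1Z) ≤ λ(X0)` give `m ≤ λ(X)`.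
[cite: Kobayashi2003, Thm. 7.3 ((7.21), p. 13)] [cite: Washington1997, §13.2] -/
theorem le_finrank_baseChange_of_fourTerm (hQ : Module.IsTorsion (PowerSeries A) Q) (hX : Module.IsTorsion (PowerSeries A) X)
    (f : H1Z →ₗ[A] Q) (g : Q →ₗ[A] X) (h : X →ₗ[A] X0) (hf : Function.Injective f) (hfg : Function.Exact f g)
    (hgh : Function.Exact g h) (hh : Function.Surjective h) {m : ℕ} (hm : m ≤ Module.finrank K (K ⊗[A] Q))
    (hflank : Module.finrank K (K ⊗[A] H1Z) ≤ Module.finrank K (K ⊗[A] X0)) :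
    m ≤ Module.finrank K (K ⊗[A] X) := by
  haveI := finite_baseChange_of_isTorsion K Q hQ
  haveI := finite_baseChange_of_isTorsion K X hX
  have := LambdaLowerBoundO.finrank_baseChange_add_eq_of_exact K f g h hf hfg hgh hh
  omega

/-- **The same with the flank comparison SUPPLIED by the BT26 shape** (DAG N4 via H-λchar) **and compact Poitou–Tate**
(V7: `λ(𝐇²) ≤ λ(X₀^{prim})`): `(C c)·char(H2) = (C d)·char(H1Z)`, `λ(H2) ≤ λ(X0)`, `m ≤ λ(Q)` ⇒ `m ≤ λ(X)`.
[cite: BurungaleTian2026, Thm. 2.6 (p. 5)] [cite: Kobayashi2003, Thm. 7.3 ((7.21), p. 13)] -/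
theorem le_finrank_baseChange_of_fourTerm_of_span_C_mul_charIdeal_eq {H2 : Type v'} [AddCommGroup H2]
    [Module (PowerSeries A) H2] [Module A H2] [IsScalarTower A (PowerSeries A) H2] [Module.Finite (PowerSeries A) H2]
    [Module (PowerSeries A) H1Z] [IsScalarTower A (PowerSeries A) H1Z] [Module.Finite (PowerSeries A) H1Z] (hH2 : Module.IsTorsion (PowerSeries A) H2)
    (hH1Z : Module.IsTorsion (PowerSeries A) H1Z) {c d : A} (hc : c ≠ 0) (hd : d ≠ 0)
    (hBT : Ideal.span {PowerSeries.C c} * Module.charIdeal (PowerSeries A) H2 =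
      Ideal.span {PowerSeries.C d} * Module.charIdeal (PowerSeries A) H1Z)
    (hPT : Module.finrank K (K ⊗[A] H2) ≤ Module.finrank K (K ⊗[A] X0))
    (hQ : Module.IsTorsion (PowerSeries A) Q) (hX : Module.IsTorsion (PowerSeries A) X)
    (f : H1Z →ₗ[A] Q) (g : Q →ₗ[A] X) (h : X →ₗ[A] X0) (hf : Function.Injective f) (hfg : Function.Exact f g)
    (hgh : Function.Exact g h) (hh : Function.Surjective h) {m : ℕ} (hm : m ≤ Module.finrank K (K ⊗[A] Q)) :
    m ≤ Module.finrank K (K ⊗[A] X) :=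
  le_finrank_baseChange_of_fourTerm K hQ hX f g h hf hfg hgh hh hm
    ((finrank_baseChange_eq_of_span_C_mul_charIdeal_eq K H2 H1Z hH2 hH1Z hc hd hBT).symm.le.trans hPT)

omit [Module (PowerSeries A) X] [IsScalarTower A (PowerSeries A) X] [Module.Finite (PowerSeries A) X] in
/-- **Imprimitive increment** (DAG N6 / Step 7 in λ-currency): an exact `0 → L → XS → X → 0` of `A`-modules with `XS` a
finitely generated torsion `Λ`-module (`L = (⊕_{v∈S₀} H¹(ℚ_{∞,v}, A_g))^∨`, `XS = X⁺_{S₀}`, `X = X⁺_∅`), `s ≤ λ(L)` and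
`m ≤ λ(X)` give `m + s ≤ λ(XS)`. [cite: GreenbergVatsal2000, §2 (Cor. 2.3)] [cite: Washington1997, §13.2] -/
theorem add_le_finrank_baseChange_of_shortExact {L : Type v} {XS : Type v} [AddCommGroup L] [Module A L]
    [AddCommGroup XS] [Module (PowerSeries A) XS] [Module A XS] [IsScalarTower A (PowerSeries A) XS]
    [Module.Finite (PowerSeries A) XS] (hXS : Module.IsTorsion (PowerSeries A) XS)
    (i : L →ₗ[A] XS) (π : XS →ₗ[A] X) (hi : Function.Injective i) (hiπ : Function.Exact i π)
    (hπ : Function.Surjective π) {m s : ℕ} (hs : s ≤ Module.finrank K (K ⊗[A] L))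
    (hm : m ≤ Module.finrank K (K ⊗[A] X)) : m + s ≤ Module.finrank K (K ⊗[A] XS) := by
  haveI := finite_baseChange_of_isTorsion K XS hXS
  have := LambdaLowerBoundO.finrank_baseChange_eq_of_exact_three K i π hi hiπ hπ
  omega

omit [IsAdicComplete (IsLocalRing.maximalIdeal A) A] [Module (PowerSeries A) X] [IsScalarTower A (PowerSeries A) X]
  [Module.Finite (PowerSeries A) X] in
/-- **Back to the `rank_A(X/X_tors)` currency** of `cmLambdaLower_of_corank` (`hcorank`): for `X` finitely generated over
`A` (finite branch, `μ = 0`), `m ≤ dim_K (K ⊗_A X) ⇒ m ≤ rank_A(X/X_tors)`. [cite: Washington1997, §13.2] -/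
theorem le_finrank_quotientTorsion_of_le_finrank_baseChange [Module.Finite A X] {m : ℕ}
    (hm : m ≤ Module.finrank K (K ⊗[A] X)) : m ≤ Module.finrank A (X ⧸ Submodule.torsion A X) := by
  rwa [LambdaLowerBoundO.finrank_baseChange_eq_finrank_quotientTorsion K X] at hm

end Assembly

/-! ## §4 (appended, rtt-p2 g15, STUB-PLAN rev 4 Q11′ / §3.1 (ii)) The ONE-SIDED bridge: `CharIdealLeUpToConst` ⇒
`λ(𝐇¹/Z) ≤ λ(𝐇²)`, and the four-term assembly with a one-sided flank -/

section OneSided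

variable {A : Type u} [CommRing A] [IsDomain A] [IsDiscreteValuationRing A]
  [IsAdicComplete (IsLocalRing.maximalIdeal A) A]
variable (K : Type w) [Field K] [Algebra A K] [IsFractionRing A K]

/-- **One-sided H-λchar**: for finitely generated torsion `M, N` over `Λ = A⟦X⟧` (`A` a complete DVR, `K = Frac A`) and
`c, d ∈ A ∖ 0` with `(C c)·char(M) ⊆ (C d)·char(N)` (i.e. `char(N) ∣ char(M)` off the constants): `dim_K (K ⊗_A N) ≤ dim_K (K ⊗_A M)`
(one-sided A1 `lengthAt_le_of_span_singleton_mul_charIdeal_le` at the primes `𝔭 ∌ C ϖ`, then A3 `finrank_baseChange_le_of_lengthAt_le`).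
The direction RSL_g consumes from a ONE-SIDED main-conjecture clause (STUB-PLAN rev 4 §3.1 (ii), k2-g3 `CharIdealLeUpToConst`).
[cite: Washington1997, §13.2] [cite: BurungaleTian2026, Thm. 2.6 (p. 5)] -/
theorem finrank_baseChange_le_of_span_C_mul_charIdeal_le (M : Type v) (N : Type v') [AddCommGroup M]
    [Module (PowerSeries A) M] [Module A M] [IsScalarTower A (PowerSeries A) M] [Module.Finite (PowerSeries A) M]
    [AddCommGroup N] [Module (PowerSeries A) N] [Module A N] [IsScalarTower A (PowerSeries A) N]
    [Module.Finite (PowerSeries A) N] (hM : Module.IsTorsion (PowerSeries A) M) (hN : Module.IsTorsion (PowerSeries A) N)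
    {c d : A} (hc : c ≠ 0) (hd : d ≠ 0)
    (h : Ideal.span {PowerSeries.C c} * Module.charIdeal (PowerSeries A) M ≤
      Ideal.span {PowerSeries.C d} * Module.charIdeal (PowerSeries A) N) :
    Module.finrank K (K ⊗[A] N) ≤ Module.finrank K (K ⊗[A] M) := by
  obtain ⟨ϖ, hϖ⟩ := IsDiscreteValuationRing.exists_irreducible A
  have hC : ∀ {a : A}, a ≠ 0 → (PowerSeries.C a : PowerSeries A) ≠ 0 := fun ha h0 ↦
    ha (by simpa using congrArg PowerSeries.constantCoeff h0)
  exact finrank_baseChange_le_of_lengthAt_le K hϖ N M hN hM fun 𝔭 h𝔭 hϖ𝔭 ↦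
    lengthAt_le_of_span_singleton_mul_charIdeal_le hM hN (hC hc) (hC hd) h 𝔭 h𝔭
      (fun h ↦ hϖ𝔭 (C_mem_of_C_mem hϖ hc 𝔭 h)) (fun h ↦ hϖ𝔭 (C_mem_of_C_mem hϖ hd 𝔭 h))

/-- One-sided H-λchar in the `rank_A(·/torsion)` currency (finite branch: `M, N` also `A`-finitely generated).
[cite: Washington1997, §13.2] -/
theorem finrank_quotientTorsion_le_of_span_C_mul_charIdeal_le (M : Type v) (N : Type v') [AddCommGroup M]
    [Module (PowerSeries A) M] [Module A M] [IsScalarTower A (PowerSeries A) M] [Module.Finite (PowerSeries A) M]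
    [Module.Finite A M] [AddCommGroup N] [Module (PowerSeries A) N] [Module A N] [IsScalarTower A (PowerSeries A) N]
    [Module.Finite (PowerSeries A) N] [Module.Finite A N] (hM : Module.IsTorsion (PowerSeries A) M)
    (hN : Module.IsTorsion (PowerSeries A) N) {c d : A} (hc : c ≠ 0) (hd : d ≠ 0)
    (h : Ideal.span {PowerSeries.C c} * Module.charIdeal (PowerSeries A) M ≤
      Ideal.span {PowerSeries.C d} * Module.charIdeal (PowerSeries A) N) :
    Module.finrank A (N ⧸ Submodule.torsion A N) ≤ Module.finrank A (M ⧸ Submodule.torsion A M) := by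
  rw [← LambdaLowerBoundO.finrank_baseChange_eq_finrank_quotientTorsion (FractionRing A) M,
    ← LambdaLowerBoundO.finrank_baseChange_eq_finrank_quotientTorsion (FractionRing A) N]
  exact finrank_baseChange_le_of_span_C_mul_charIdeal_le (FractionRing A) M N hM hN hc hd h

variable {H1Z Q X X0 : Type v}
  [AddCommGroup H1Z] [Module (PowerSeries A) H1Z] [Module A H1Z] [IsScalarTower A (PowerSeries A) H1Z]
  [Module.Finite (PowerSeries A) H1Z]
  [AddCommGroup Q] [Module (PowerSeries A) Q] [Module A Q] [IsScalarTower A (PowerSeries A) Q]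
  [Module.Finite (PowerSeries A) Q]
  [AddCommGroup X] [Module (PowerSeries A) X] [Module A X] [IsScalarTower A (PowerSeries A) X]
  [Module.Finite (PowerSeries A) X]
  [AddCommGroup X0] [Module A X0]

/-- **Four-term assembly with the ONE-SIDED flank** `(C c)·char(H2) ⊆ (C d)·char(H1Z)` (`char(𝐇¹/Z) ∣ char(𝐇²)` off constants,
the direction RSL_g consumes) and compact Poitou–Tate `λ(H2) ≤ λ(X0)`: `m ≤ λ(Q) ⇒ m ≤ λ(X)`.
[cite: BurungaleTian2026, Thm. 2.6 (p. 5)] [cite: Kobayashi2003, Thm. 7.3 ((7.21), p. 13)] -/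
theorem le_finrank_baseChange_of_fourTerm_of_span_C_mul_charIdeal_le {H2 : Type v'} [AddCommGroup H2]
    [Module (PowerSeries A) H2] [Module A H2] [IsScalarTower A (PowerSeries A) H2] [Module.Finite (PowerSeries A) H2]
    (hH2 : Module.IsTorsion (PowerSeries A) H2) (hH1Z : Module.IsTorsion (PowerSeries A) H1Z) {c d : A} (hc : c ≠ 0)
    (hd : d ≠ 0)
    (hBT : Ideal.span {PowerSeries.C c} * Module.charIdeal (PowerSeries A) H2 ≤
      Ideal.span {PowerSeries.C d} * Module.charIdeal (PowerSeries A) H1Z)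
    (hPT : Module.finrank K (K ⊗[A] H2) ≤ Module.finrank K (K ⊗[A] X0))
    (hQ : Module.IsTorsion (PowerSeries A) Q) (hX : Module.IsTorsion (PowerSeries A) X)
    (f : H1Z →ₗ[A] Q) (g : Q →ₗ[A] X) (h : X →ₗ[A] X0) (hf : Function.Injective f) (hfg : Function.Exact f g)
    (hgh : Function.Exact g h) (hh : Function.Surjective h) {m : ℕ} (hm : m ≤ Module.finrank K (K ⊗[A] Q)) :
    m ≤ Module.finrank K (K ⊗[A] X) :=
  le_finrank_baseChange_of_fourTerm K hQ hX f g h hf hfg hgh hh hm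
    ((finrank_baseChange_le_of_span_C_mul_charIdeal_le K H2 H1Z hH2 hH1Z hc hd hBT).trans hPT)

end OneSided

section KatoPackageOneSided

open Literature.NumberTheory.GaloisRepresentations Literature.NumberTheory.EllipticCurves.Kato2004

/-- **N4 one-sided, in λ-currency: `(C c)·char(𝐇²) ⊆ (C d)·char(𝐇¹/Z)` ⇒ `λ(𝐇¹_Γ(T)/Z) ≤ λ(𝐇²)`** — the direction RSL_g consumes
(the CM / elliptic-unit half, OPPOSITE to Kato 12.5 (4)), on Kato's package `P` over a complete DVR `A` with fraction field `F`,
`𝐇¹_Γ(T)` finitely generated (Kato 12.4); the hypothesis is k2-g3's `CharIdealLeUpToConst P` unfolded (STUB-PLAN rev 4 §3.1 (ii)).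
[cite: BurungaleTian2026, Thm. 2.6 (p. 5)] [cite: Kato2004Asterisque, Thm. 12.4 (p. 221) and §12.10 (p. 223)] -/
theorem finrank_baseChange_zetaQuotient_le_H2_of_span_C_mul_charIdeal_le {A : Type} [CommRing A] [TopologicalSpace A]
    [IsDomain A] [IsDiscreteValuationRing A] [IsAdicComplete (IsLocalRing.maximalIdeal A) A] {V : Type}
    [AddCommGroup V] [Module A V] [TopologicalSpace V] [IsTopologicalAddGroup V] [ContinuousSMul A V]
    {T : GaloisRep ℚ A V} {p : ℕ} [Fact p.Prime] {κ : ZpExtension ℚ p} {γ : Field.absoluteGaloisGroup ℚ}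
    {I : IwasawaH1DataCoeff T p κ γ} (hI : Module.Finite (PowerSeries A) I.H) [Module A I.H]
    [IsScalarTower A (PowerSeries A) I.H] (P : ZetaQuotientPackage I) [Module A P.H2]
    [IsScalarTower A (PowerSeries A) P.H2]
    (hP : ∃ c d : A, c ≠ 0 ∧ d ≠ 0 ∧
      Ideal.span {PowerSeries.C c} * P.charH2 ≤ Ideal.span {PowerSeries.C d} * P.charZetaQuotient)
    (F : Type w) [Field F] [Algebra A F] [IsFractionRing A F] :
    Module.finrank F (F ⊗[A] (I.H ⧸ P.Z)) ≤ Module.finrank F (F ⊗[A] P.H2) := by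
  obtain ⟨c, d, hc, hd, h⟩ := hP
  haveI := hI
  haveI : Module.Finite (PowerSeries A) P.H2 := P.finite_H2
  exact finrank_baseChange_le_of_span_C_mul_charIdeal_le F P.H2 (I.H ⧸ P.Z) P.isTorsion_H2 P.isTorsion_quotient hc hd h

end KatoPackageOneSided

end Summit.BirchSwinnertonDyer.BirchSwinnertonDyer.Theorems.CharIdealLambda

end
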